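import Literature.NumberTheory.Automorphic.UnitaryGroupTruncatedKernelClassBorelCount
import Literature.NumberTheory.Automorphic.UnitaryGroupBorelRefinedClassMap
import HarnessLib

/-!
# The regular hyperbolic class of the Borel-refined characteristic-polynomial class map:
# its fibre is the `G(F)`-conjugacy class of `γ♯ = d(a, b, (c a)⁻¹)`, it carries a section, and
# Arthur's `j`-kernel holds for it with no class-map hypothesis
(Rogawski, *Automorphic Representations of Unitary Groups in Three Variables* (1990), §2.2–2.3 pp. 13–14
(the classes `𝔬`), §3.6 p. 27 (regular elements), §6.1 pp. 79–81 (the hyperbolic term); Arthur, *A trace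
formula for reductive groups I*, Duke Math. J. 45 (1978), §8.)

The socket (σ-iii) of ★ `arthurTrace_eq_sum_orbital_add_sum_central_add_sum_singular_add_sum_hyperbolic_cm`
is indexed by the refined classes `i♯ = (((X − a)(X − b)(X − (c a)⁻¹)) ⊗ 𝔸_E, true)` with `c a · a ≠ 1`,
`c b · b = 1`, of the Borel-refined class map
`cl♭ γ = (charpoly (adelicVal γ), decide (∃ δ ∈ G(F), δ γ δ⁻¹ ∈ B(F)))` (★ `UnitaryGroupBorelRefinedClassMap`).
This file pins the abstract letters `(cl, hcl, i, sec, hsec)` of Arthur's `j`-kernel ★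
`truncatedKernelClass_eq_tsum_mul_weight_sub_sum_of_hyperbolic` (★ `UnitaryGroupTruncatedKernelClassBorelCount`)
to that class map:

* §1 the base point `γ♯ := ι(g₀)`, `g₀ = d(a, b, (c a)⁻¹) ∈ U(J₃)(F)`: upper triangular, in `B(F)`, rational and
  adelic characteristic polynomial `(X − a)(X − b)(X − (c a)⁻¹)`;
* §2 THE FIBRE: `cl♭ γ = i♯ ↔ charpoly (adelicVal γ) = p♯ ⊗ 𝔸_E ↔ ∃ δ ∈ G(F), δ γ δ⁻¹ = γ♯` (★
  `exists_conj_eq_mk_toAdelic_of_hyperbolic`: a regular split semisimple class of `U(J₃)(F)` is ONE `G(F)`-conjugacy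
  class, and it meets `B(F)`, so the Borel flag is automatically `true`); `cl♭ γ♯ = i♯`; hence A SECTION
  `sec : cl♭⁻¹{i♯} → G(F)` with `(sec γ)⁻¹ γ♯ (sec γ) = γ` exists (`exists_section_borelRefine_hyperbolic`);
* §3 Arthur's `j`-kernel for the refined hyperbolic class: ★ `truncatedKernelClass_eq_tsum_mul_weight_sub_sum_of_hyperbolic`
  with `IsConjInvariant cl♭` discharged by ★ `isConjInvariant_borelRefine isConjInvariant_charpoly_adelicVal`.
* §4 THE CENTRALISER OF `γ♯` IN `G(F)` IS `G(F) ∩ T(𝔸_F)`: `δ ∈ Z_{G(F)}(γ♯) ↔ δ ∈ T(𝔸_F)` (regular rigidity ★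
  `blockTriangular_of_commute_regular`; diagonal matrices commute) — the lattice `Λ = G_γ(F)` of the unfolding of the
  `j`-kernel over `G_γ(F)∖G(𝔸)` is the rational torus, so covering weights of `Λ` restrict to covering weights of
  `T(F) ≤ T(𝔸_F)` (the hypothesis `hΛ` of the torus-fibre step).

Theorems only; no definitions, no instances, no notation.
-/

open MeasureTheory Measure NumberField IsDedekindDomain Set Matrix Polynomial
open scoped NNReal ENNReal Classical MatrixGroups

namespace Literature.NumberTheory.Automorphic

namespace UnitaryGroup

variable {F E : Type} [Field F] [NumberField F] [Field E] [NumberField E] [Algebra F E]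
  {c : E ≃ₐ[F] E}

/-! ## §1 The base point `γ♯ = d(a, b, (c a)⁻¹)` -/

section BasePoint

/-- `d(a, b, (c a)⁻¹)` is upper triangular. [cite: Rogawski1990, §1.10] -/
theorem blockTriangular_of_eq_hyperbolicDiagonal {g₀ : (quasiSplit F E c 3).Rational} {a b : Eˣ}
    (hg₀ : ((g₀.1 : GL (Fin 3) E) : Matrix (Fin 3) (Fin 3) E) = !![(a : E), 0, 0; 0, b, 0; 0, 0, (c (a : E))⁻¹]) :
    (((g₀.1 : GL (Fin 3) E) : Matrix (Fin 3) (Fin 3) E)).BlockTriangular id := by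
  rw [hg₀]
  intro i j hij
  fin_cases i <;> fin_cases j <;> simp_all

/-- **`γ♯ = ι(d(a, b, (c a)⁻¹))` lies in the rational Borel `B(F)`.** [cite: Rogawski1990, §1.10; §2.3 (p. 14)] -/
theorem mk_toAdelic_mem_arithmeticBorel_of_eq_hyperbolicDiagonal {g₀ : (quasiSplit F E c 3).Rational} {a b : Eˣ}
    (hg₀ : ((g₀.1 : GL (Fin 3) E) : Matrix (Fin 3) (Fin 3) E) = !![(a : E), 0, 0; 0, b, 0; 0, 0, (c (a : E))⁻¹]) :
    (⟨(quasiSplit F E c 3).toAdelic g₀, g₀, rfl⟩ : (quasiSplit F E c 3).arithmeticSubgroup) ∈ arithmeticBorel F E c 3 := by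
  rw [mem_arithmeticBorel_iff]
  exact (toAdelic_mem_borelAdelic_iff g₀).2 (blockTriangular_of_eq_hyperbolicDiagonal hg₀)

/-- **The characteristic polynomial of `d(a, b, (c a)⁻¹)` is `(X − a)(X − b)(X − (c a)⁻¹)`** — the class (iii)
«REGULAR HYPERBOLIC» of ★ `meetsBorel_trichotomy` when `c a · a ≠ 1`. [cite: Rogawski1990, §3.6 (p. 27); §6.1 (p. 79)] -/
theorem charpoly_of_eq_hyperbolicDiagonal {g₀ : (quasiSplit F E c 3).Rational} {a b : Eˣ}
    (hg₀ : ((g₀.1 : GL (Fin 3) E) : Matrix (Fin 3) (Fin 3) E) = !![(a : E), 0, 0; 0, b, 0; 0, 0, (c (a : E))⁻¹]) :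
    (((g₀.1 : GL (Fin 3) E) : Matrix (Fin 3) (Fin 3) E)).charpoly =
      (X - C (a : E)) * (X - C (b : E)) * (X - C (c (a : E))⁻¹) := by
  rw [Matrix.charpoly_of_upperTriangular _ (blockTriangular_of_eq_hyperbolicDiagonal hg₀), Fin.prod_univ_three, hg₀]
  simp

/-- The same for the adelic characteristic polynomial of `γ♯`: `charpoly (adelicVal γ♯) = p♯ ⊗ 𝔸_E`.
[cite: Rogawski1990, §2.2 (p. 13); §6.1 (p. 79)] -/
theorem charpoly_adelicVal_toAdelic_of_eq_hyperbolicDiagonal {g₀ : (quasiSplit F E c 3).Rational} {a b : Eˣ}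
    (hg₀ : ((g₀.1 : GL (Fin 3) E) : Matrix (Fin 3) (Fin 3) E) = !![(a : E), 0, 0; 0, b, 0; 0, 0, (c (a : E))⁻¹]) :
    ((adelicVal F E c 3 _ ((quasiSplit F E c 3).toAdelic g₀) : GL (Fin 3) (AdeleRing (𝓞 E) E)) :
        Matrix (Fin 3) (Fin 3) (AdeleRing (𝓞 E) E)).charpoly =
      ((X - C (a : E)) * (X - C (b : E)) * (X - C (c (a : E))⁻¹)).map (algebraMap E (AdeleRing (𝓞 E) E)) := by
  rw [charpoly_adelicVal_toAdelic, charpoly_of_eq_hyperbolicDiagonal hg₀]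

end BasePoint

/-! ## §2 The fibre of `cl♭` over the refined hyperbolic class -/

section Fibre

/-- **THE REFINED HYPERBOLIC CLASS IS READ ON THE CHARACTERISTIC POLYNOMIAL ALONE**: for `c a · a ≠ 1`,
`cl♭ γ = (p♯ ⊗ 𝔸_E, true) ↔ charpoly (adelicVal γ) = p♯ ⊗ 𝔸_E` — a rational element of that characteristic
polynomial is automatically `G(F)`-conjugate into `B(F)` (★ `forall_exists_conj_mem_arithmeticBorel_of_hyperbolic`),
so the Borel flag is `true`. [cite: Rogawski1990, §2.3 (p. 14); §3.6 (p. 27)] -/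
theorem borelRefine_charpoly_eq_hyperbolic_iff (hc : c * c = 1) {a : Eˣ} (b : Eˣ) (ha : c (a : E) * (a : E) ≠ 1)
    (γ : (quasiSplit F E c 3).arithmeticSubgroup) :
    (fun γ : (quasiSplit F E c 3).arithmeticSubgroup =>
        (((adelicVal F E c 3 _ (γ : (quasiSplit F E c 3).Adelic) : GL (Fin 3) (AdeleRing (𝓞 E) E)) :
            Matrix (Fin 3) (Fin 3) (AdeleRing (𝓞 E) E)).charpoly,
          decide (∃ δ : (quasiSplit F E c 3).arithmeticSubgroup, δ * γ * δ⁻¹ ∈ arithmeticBorel F E c 3))) γ =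
        (((X - C (a : E)) * (X - C (b : E)) * (X - C (c (a : E))⁻¹)).map (algebraMap E (AdeleRing (𝓞 E) E)), true) ↔
      ((adelicVal F E c 3 _ (γ : (quasiSplit F E c 3).Adelic) : GL (Fin 3) (AdeleRing (𝓞 E) E)) :
          Matrix (Fin 3) (Fin 3) (AdeleRing (𝓞 E) E)).charpoly =
        ((X - C (a : E)) * (X - C (b : E)) * (X - C (c (a : E))⁻¹)).map (algebraMap E (AdeleRing (𝓞 E) E)) := by
  constructor
  · intro h
    exact (Prod.mk.injEq _ _ _ _ ▸ h).1
  · intro h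
    simp only [Prod.mk.injEq]
    exact ⟨h, decide_eq_true (forall_exists_conj_mem_arithmeticBorel_of_hyperbolic hc b ha γ h)⟩

/-- **THE FIBRE IS ONE `G(F)`-CONJUGACY CLASS**: `cl♭ γ = (p♯ ⊗ 𝔸_E, true) ↔ ∃ δ ∈ G(F), δ γ δ⁻¹ = γ♯`
(★ `exists_conj_eq_mk_toAdelic_of_hyperbolic`; conversely conjugation preserves `charpoly ∘ adelicVal`).
[cite: Rogawski1990, §2.3 (p. 14); §3.6 (p. 27)] -/
theorem borelRefine_charpoly_eq_hyperbolic_iff_exists_conj (hc : c * c = 1) {a b : Eˣ} (ha : c (a : E) * (a : E) ≠ 1)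
    (hb : c (b : E) * (b : E) = 1) {g₀ : (quasiSplit F E c 3).Rational}
    (hg₀ : ((g₀.1 : GL (Fin 3) E) : Matrix (Fin 3) (Fin 3) E) = !![(a : E), 0, 0; 0, b, 0; 0, 0, (c (a : E))⁻¹])
    (γ : (quasiSplit F E c 3).arithmeticSubgroup) :
    (fun γ : (quasiSplit F E c 3).arithmeticSubgroup =>
        (((adelicVal F E c 3 _ (γ : (quasiSplit F E c 3).Adelic) : GL (Fin 3) (AdeleRing (𝓞 E) E)) :
            Matrix (Fin 3) (Fin 3) (AdeleRing (𝓞 E) E)).charpoly,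
          decide (∃ δ : (quasiSplit F E c 3).arithmeticSubgroup, δ * γ * δ⁻¹ ∈ arithmeticBorel F E c 3))) γ =
        (((X - C (a : E)) * (X - C (b : E)) * (X - C (c (a : E))⁻¹)).map (algebraMap E (AdeleRing (𝓞 E) E)), true) ↔
      ∃ δ : (quasiSplit F E c 3).arithmeticSubgroup,
        δ * γ * δ⁻¹ = ⟨(quasiSplit F E c 3).toAdelic g₀, g₀, rfl⟩ := by
  rw [borelRefine_charpoly_eq_hyperbolic_iff hc b ha γ]
  obtain ⟨w, hw⟩ := exists_rational_eq_weyl (F := F) (E := E) (c := c)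
  constructor
  · intro h
    exact exists_conj_eq_mk_toAdelic_of_hyperbolic hc ha hb hg₀ hw h
  · rintro ⟨δ, hδ⟩
    have h := isConjInvariant_charpoly_adelicVal (F := F) (E := E) (c := c) (N := 3) γ δ
    simp only [hδ] at h
    rw [← h]
    exact charpoly_adelicVal_toAdelic_of_eq_hyperbolicDiagonal hg₀

/-- **`γ♯` lies in its own refined class**: `cl♭ γ♯ = (p♯ ⊗ 𝔸_E, true)`. [cite: Rogawski1990, §2.3 (p. 14)] -/
theorem borelRefine_charpoly_mk_toAdelic_of_eq_hyperbolicDiagonal (hc : c * c = 1) {a b : Eˣ}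
    (ha : c (a : E) * (a : E) ≠ 1) {g₀ : (quasiSplit F E c 3).Rational}
    (hg₀ : ((g₀.1 : GL (Fin 3) E) : Matrix (Fin 3) (Fin 3) E) = !![(a : E), 0, 0; 0, b, 0; 0, 0, (c (a : E))⁻¹]) :
    (fun γ : (quasiSplit F E c 3).arithmeticSubgroup =>
        (((adelicVal F E c 3 _ (γ : (quasiSplit F E c 3).Adelic) : GL (Fin 3) (AdeleRing (𝓞 E) E)) :
            Matrix (Fin 3) (Fin 3) (AdeleRing (𝓞 E) E)).charpoly,
          decide (∃ δ : (quasiSplit F E c 3).arithmeticSubgroup, δ * γ * δ⁻¹ ∈ arithmeticBorel F E c 3)))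
        ⟨(quasiSplit F E c 3).toAdelic g₀, g₀, rfl⟩ =
      (((X - C (a : E)) * (X - C (b : E)) * (X - C (c (a : E))⁻¹)).map (algebraMap E (AdeleRing (𝓞 E) E)), true) :=
  (borelRefine_charpoly_eq_hyperbolic_iff hc b ha _).2 (charpoly_adelicVal_toAdelic_of_eq_hyperbolicDiagonal hg₀)

/-- **THE REFINED HYPERBOLIC FIBRE IS NONEMPTY** (it contains `γ♯`). [cite: Rogawski1990, §2.3 (p. 14)] -/
theorem mk_toAdelic_mem_preimage_borelRefine_charpoly_hyperbolic (hc : c * c = 1) {a b : Eˣ}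
    (ha : c (a : E) * (a : E) ≠ 1) {g₀ : (quasiSplit F E c 3).Rational}
    (hg₀ : ((g₀.1 : GL (Fin 3) E) : Matrix (Fin 3) (Fin 3) E) = !![(a : E), 0, 0; 0, b, 0; 0, 0, (c (a : E))⁻¹]) :
    (⟨(quasiSplit F E c 3).toAdelic g₀, g₀, rfl⟩ : (quasiSplit F E c 3).arithmeticSubgroup) ∈
      (fun γ : (quasiSplit F E c 3).arithmeticSubgroup =>
        (((adelicVal F E c 3 _ (γ : (quasiSplit F E c 3).Adelic) : GL (Fin 3) (AdeleRing (𝓞 E) E)) :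
            Matrix (Fin 3) (Fin 3) (AdeleRing (𝓞 E) E)).charpoly,
          decide (∃ δ : (quasiSplit F E c 3).arithmeticSubgroup, δ * γ * δ⁻¹ ∈ arithmeticBorel F E c 3))) ⁻¹'
        {(((X - C (a : E)) * (X - C (b : E)) * (X - C (c (a : E))⁻¹)).map (algebraMap E (AdeleRing (𝓞 E) E)), true)} :=
  borelRefine_charpoly_mk_toAdelic_of_eq_hyperbolicDiagonal hc ha hg₀

/-- **A SECTION OF THE REFINED HYPERBOLIC FIBRE**: there is `sec : cl♭⁻¹{i♯} → G(F)` with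
`(sec γ)⁻¹ · γ♯ · (sec γ) = γ` for every `γ` of the class — the letters `(sec, hsec)` of Arthur's `j`-kernel ★
`truncatedKernelClass_eq_tsum_mul_weight_sub_sum_of_hyperbolic`. [cite: Arthur1978TraceFormulaI, §8]
[cite: Rogawski1990, §6.1 (p. 79)] -/
theorem exists_section_borelRefine_hyperbolic (hc : c * c = 1) {a b : Eˣ} (ha : c (a : E) * (a : E) ≠ 1)
    (hb : c (b : E) * (b : E) = 1) {g₀ : (quasiSplit F E c 3).Rational}
    (hg₀ : ((g₀.1 : GL (Fin 3) E) : Matrix (Fin 3) (Fin 3) E) = !![(a : E), 0, 0; 0, b, 0; 0, 0, (c (a : E))⁻¹]) :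
    ∃ sec : ((fun γ : (quasiSplit F E c 3).arithmeticSubgroup =>
        (((adelicVal F E c 3 _ (γ : (quasiSplit F E c 3).Adelic) : GL (Fin 3) (AdeleRing (𝓞 E) E)) :
            Matrix (Fin 3) (Fin 3) (AdeleRing (𝓞 E) E)).charpoly,
          decide (∃ δ : (quasiSplit F E c 3).arithmeticSubgroup, δ * γ * δ⁻¹ ∈ arithmeticBorel F E c 3))) ⁻¹'
        {(((X - C (a : E)) * (X - C (b : E)) * (X - C (c (a : E))⁻¹)).map (algebraMap E (AdeleRing (𝓞 E) E)), true)}) →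
        (quasiSplit F E c 3).arithmeticSubgroup,
      ∀ γ, (sec γ)⁻¹ * ⟨(quasiSplit F E c 3).toAdelic g₀, g₀, rfl⟩ * sec γ =
        (γ : (quasiSplit F E c 3).arithmeticSubgroup) := by
  have h : ∀ γ : ((fun γ : (quasiSplit F E c 3).arithmeticSubgroup =>
        (((adelicVal F E c 3 _ (γ : (quasiSplit F E c 3).Adelic) : GL (Fin 3) (AdeleRing (𝓞 E) E)) :
            Matrix (Fin 3) (Fin 3) (AdeleRing (𝓞 E) E)).charpoly,
          decide (∃ δ : (quasiSplit F E c 3).arithmeticSubgroup, δ * γ * δ⁻¹ ∈ arithmeticBorel F E c 3))) ⁻¹'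
        {(((X - C (a : E)) * (X - C (b : E)) * (X - C (c (a : E))⁻¹)).map (algebraMap E (AdeleRing (𝓞 E) E)), true)}),
      ∃ δ : (quasiSplit F E c 3).arithmeticSubgroup,
        δ * (γ : (quasiSplit F E c 3).arithmeticSubgroup) * δ⁻¹ = ⟨(quasiSplit F E c 3).toAdelic g₀, g₀, rfl⟩ := by
    intro γ
    have hγ := γ.2
    rw [Set.mem_preimage, Set.mem_singleton_iff] at hγ
    exact (borelRefine_charpoly_eq_hyperbolic_iff_exists_conj hc ha hb hg₀ _).1 hγ
  choose sec hsec using h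
  refine ⟨sec, fun γ => ?_⟩
  rw [← hsec γ]
  group

end Fibre

/-! ## §3 Arthur's `j`-kernel for the refined hyperbolic class -/

section JKernel

variable [MeasurableSpace (adelicUnipotent F E c 3)]

/-- **ARTHUR'S `j`-KERNEL FOR THE REFINED REGULAR HYPERBOLIC CLASS** `i♯ = (p♯ ⊗ 𝔸_E, true)` of `cl♭`: for
`T > 0`, `f` of compact support and any section `sec` of the fibre (`exists_section_borelRefine_hyperbolic`),
`k^T_{i♯}(x) = Σ'_{γ′ ∈ cl♭⁻¹{i♯}} f(x⁻¹γ′x)·(1 − [T < H(sec γ′·x)] − [T < H(w♯·sec γ′·x)]) − Σ_{q ∈ S_T(x)} (K_{B,i♯} − K^Σ_{B,i♯})(q̃x, q̃x)`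
— ★ `truncatedKernelClass_eq_tsum_mul_weight_sub_sum_of_hyperbolic` with `IsConjInvariant cl♭` discharged (★
`isConjInvariant_borelRefine`, ★ `isConjInvariant_charpoly_adelicVal`). [cite: Arthur1978TraceFormulaI, §8]
[cite: Rogawski1990, §6.1 (pp. 79–81)] -/
theorem truncatedKernelClass_borelRefine_hyperbolic_eq_tsum_mul_weight_sub_sum (ν : Measure (adelicUnipotent F E c 3))
    (𝓕 : Set (adelicUnipotent F E c 3)) (hc : c * c = 1) {a b : Eˣ} (ha : c (a : E) * (a : E) ≠ 1)
    (hb : c (b : E) * (b : E) = 1) {g₀ w : (quasiSplit F E c 3).Rational}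
    (hg₀ : ((g₀.1 : GL (Fin 3) E) : Matrix (Fin 3) (Fin 3) E) = !![(a : E), 0, 0; 0, b, 0; 0, 0, (c (a : E))⁻¹])
    (hw : ((w.1 : GL (Fin 3) E) : Matrix (Fin 3) (Fin 3) E) = !![(0 : E), 0, 1; 0, 1, 0; 1, 0, 0])
    {T : ℝ≥0} (hT : 0 < T)
    (sec : ((fun γ : (quasiSplit F E c 3).arithmeticSubgroup =>
        (((adelicVal F E c 3 _ (γ : (quasiSplit F E c 3).Adelic) : GL (Fin 3) (AdeleRing (𝓞 E) E)) :
            Matrix (Fin 3) (Fin 3) (AdeleRing (𝓞 E) E)).charpoly,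
          decide (∃ δ : (quasiSplit F E c 3).arithmeticSubgroup, δ * γ * δ⁻¹ ∈ arithmeticBorel F E c 3))) ⁻¹'
        {(((X - C (a : E)) * (X - C (b : E)) * (X - C (c (a : E))⁻¹)).map (algebraMap E (AdeleRing (𝓞 E) E)), true)}) →
        (quasiSplit F E c 3).arithmeticSubgroup)
    (hsec : ∀ γ, (sec γ)⁻¹ * ⟨(quasiSplit F E c 3).toAdelic g₀, g₀, rfl⟩ * sec γ =
        (γ : (quasiSplit F E c 3).arithmeticSubgroup))
    {f : (quasiSplit F E c 3).Adelic → ℂ} (hf : HasCompactSupport f) (x : (quasiSplit F E c 3).Adelic) :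
    truncatedKernelClass ν 𝓕 T
        (fun γ : (quasiSplit F E c 3).arithmeticSubgroup =>
          (((adelicVal F E c 3 _ (γ : (quasiSplit F E c 3).Adelic) : GL (Fin 3) (AdeleRing (𝓞 E) E)) :
              Matrix (Fin 3) (Fin 3) (AdeleRing (𝓞 E) E)).charpoly,
            decide (∃ δ : (quasiSplit F E c 3).arithmeticSubgroup, δ * γ * δ⁻¹ ∈ arithmeticBorel F E c 3)))
        (((X - C (a : E)) * (X - C (b : E)) * (X - C (c (a : E))⁻¹)).map (algebraMap E (AdeleRing (𝓞 E) E)), true) f x =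
      (∑' γ : ((fun γ : (quasiSplit F E c 3).arithmeticSubgroup =>
          (((adelicVal F E c 3 _ (γ : (quasiSplit F E c 3).Adelic) : GL (Fin 3) (AdeleRing (𝓞 E) E)) :
              Matrix (Fin 3) (Fin 3) (AdeleRing (𝓞 E) E)).charpoly,
            decide (∃ δ : (quasiSplit F E c 3).arithmeticSubgroup, δ * γ * δ⁻¹ ∈ arithmeticBorel F E c 3))) ⁻¹'
          {(((X - C (a : E)) * (X - C (b : E)) * (X - C (c (a : E))⁻¹)).map (algebraMap E (AdeleRing (𝓞 E) E)), true)}),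
        f (x⁻¹ * ((γ : (quasiSplit F E c 3).arithmeticSubgroup) : (quasiSplit F E c 3).Adelic) * x) *
          (1 - (if T < borelHeight (((sec γ : (quasiSplit F E c 3).arithmeticSubgroup) : (quasiSplit F E c 3).Adelic) * x)
                  then (1 : ℂ) else 0) -
               (if T < borelHeight ((((⟨(quasiSplit F E c 3).toAdelic w, w, rfl⟩ * sec γ :
                  (quasiSplit F E c 3).arithmeticSubgroup)) : (quasiSplit F E c 3).Adelic) * x) then (1 : ℂ) else 0))) -
      ∑ q ∈ (finite_setOf_lt_borelHeight x hT).toFinset,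
        (kernelBorelClass ν 𝓕
            (fun γ : (quasiSplit F E c 3).arithmeticSubgroup =>
              (((adelicVal F E c 3 _ (γ : (quasiSplit F E c 3).Adelic) : GL (Fin 3) (AdeleRing (𝓞 E) E)) :
                  Matrix (Fin 3) (Fin 3) (AdeleRing (𝓞 E) E)).charpoly,
                decide (∃ δ : (quasiSplit F E c 3).arithmeticSubgroup, δ * γ * δ⁻¹ ∈ arithmeticBorel F E c 3)))
            (((X - C (a : E)) * (X - C (b : E)) * (X - C (c (a : E))⁻¹)).map (algebraMap E (AdeleRing (𝓞 E) E)), true) f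
            (((q.out : (quasiSplit F E c 3).arithmeticSubgroup) : (quasiSplit F E c 3).Adelic) * x)
            (((q.out : (quasiSplit F E c 3).arithmeticSubgroup) : (quasiSplit F E c 3).Adelic) * x) -
          borelSumClass
            (fun γ : (quasiSplit F E c 3).arithmeticSubgroup =>
              (((adelicVal F E c 3 _ (γ : (quasiSplit F E c 3).Adelic) : GL (Fin 3) (AdeleRing (𝓞 E) E)) :
                  Matrix (Fin 3) (Fin 3) (AdeleRing (𝓞 E) E)).charpoly,
                decide (∃ δ : (quasiSplit F E c 3).arithmeticSubgroup, δ * γ * δ⁻¹ ∈ arithmeticBorel F E c 3)))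
            (((X - C (a : E)) * (X - C (b : E)) * (X - C (c (a : E))⁻¹)).map (algebraMap E (AdeleRing (𝓞 E) E)), true) f
            (((q.out : (quasiSplit F E c 3).arithmeticSubgroup) : (quasiSplit F E c 3).Adelic) * x)
            (((q.out : (quasiSplit F E c 3).arithmeticSubgroup) : (quasiSplit F E c 3).Adelic) * x)) :=
  truncatedKernelClass_eq_tsum_mul_weight_sub_sum_of_hyperbolic ν 𝓕 hc ha hb hg₀ hw hT
    (isConjInvariant_borelRefine isConjInvariant_charpoly_adelicVal) _ sec hsec hf x

end JKernel

/-! ## §4 The centraliser of `γ♯` in `G(F)` is `G(F) ∩ T(𝔸_F)` -/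

section Centraliser

/-- The adelic matrix of `ι g` is the entrywise image of the rational matrix of `g` (definitional). [folklore] -/
private theorem coe_adelicVal_toAdelic_map (g : (quasiSplit F E c 3).Rational) :
    ((adelicVal F E c 3 _ ((quasiSplit F E c 3).toAdelic g) : GL (Fin 3) (AdeleRing (𝓞 E) E)) :
        Matrix (Fin 3) (Fin 3) (AdeleRing (𝓞 E) E)) =
      ((g.val : GL (Fin 3) E) : Matrix (Fin 3) (Fin 3) E).map (algebraMap E (AdeleRing (𝓞 E) E)) :=
  rfl

/-- `ι : U(J₃)(F) → U(J₃)(𝔸_F)` is injective (`E → 𝔸_E` is). [folklore] -/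
private theorem toAdelic_injective_fibre : Function.Injective (quasiSplit F E c 3).toAdelic := by
  intro g g' h
  have hm := congrArg (fun x : (quasiSplit F E c 3).Adelic =>
    ((adelicVal F E c 3 _ x : GL (Fin 3) (AdeleRing (𝓞 E) E)) : Matrix (Fin 3) (Fin 3) (AdeleRing (𝓞 E) E))) h
  simp only [coe_adelicVal_toAdelic_map] at hm
  exact Subtype.ext (Units.ext (Matrix.map_injective (AdeleRing.algebraMap_injective (𝓞 E) E) hm))

/-- **A rational diagonal element lies in `T(𝔸_F)`**: if the matrix of `h ∈ U(J₃)(F)` is `d(h₀₀, h₁₁, h₂₂)` then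
`ι(h) ∈ T(𝔸_F)` (its adelic matrix is the diagonal of the principal idèles `(h₀₀, h₁₁, h₂₂)`, units since
`det h ≠ 0`). [cite: Rogawski1990, §1.9 (p. 9)] -/
theorem toAdelic_mem_torusAdelic_of_eq_diagonal {h : (quasiSplit F E c 3).Rational}
    (hd : ((h.1 : GL (Fin 3) E) : Matrix (Fin 3) (Fin 3) E) =
      !![((h.1 : GL (Fin 3) E) : Matrix (Fin 3) (Fin 3) E) 0 0, 0, 0;
         0, ((h.1 : GL (Fin 3) E) : Matrix (Fin 3) (Fin 3) E) 1 1, 0;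
         0, 0, ((h.1 : GL (Fin 3) E) : Matrix (Fin 3) (Fin 3) E) 2 2]) :
    (quasiSplit F E c 3).toAdelic h ∈ torusAdelic F E c 3 := by
  have hdet : ((h.1 : GL (Fin 3) E) : Matrix (Fin 3) (Fin 3) E).det ≠ 0 := by
    rw [← Matrix.GeneralLinearGroup.val_det_apply]
    exact Units.ne_zero _
  have hdet' : ((h.1 : GL (Fin 3) E) : Matrix (Fin 3) (Fin 3) E).det =
      ((h.1 : GL (Fin 3) E) : Matrix (Fin 3) (Fin 3) E) 0 0 * ((h.1 : GL (Fin 3) E) : Matrix (Fin 3) (Fin 3) E) 1 1 *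
        ((h.1 : GL (Fin 3) E) : Matrix (Fin 3) (Fin 3) E) 2 2 := by
    rw [hd, Matrix.det_fin_three]
    simp
  have h0 : ((h.1 : GL (Fin 3) E) : Matrix (Fin 3) (Fin 3) E) 0 0 ≠ 0 := by
    intro h0; apply hdet; rw [hdet', h0, zero_mul, zero_mul]
  have h1 : ((h.1 : GL (Fin 3) E) : Matrix (Fin 3) (Fin 3) E) 1 1 ≠ 0 := by
    intro h1; apply hdet; rw [hdet', h1, mul_zero, zero_mul]
  have h2 : ((h.1 : GL (Fin 3) E) : Matrix (Fin 3) (Fin 3) E) 2 2 ≠ 0 := by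
    intro h2; apply hdet; rw [hdet', h2, mul_zero]
  refine ⟨fun i => Units.map (algebraMap E (AdeleRing (𝓞 E) E) : E →* AdeleRing (𝓞 E) E)
    (![Units.mk0 _ h0, Units.mk0 _ h1, Units.mk0 _ h2] i), ?_⟩
  refine Matrix.GeneralLinearGroup.ext fun i j => ?_
  change (glDiagonal 3 (AdeleRing (𝓞 E) E) _ : Matrix (Fin 3) (Fin 3) (AdeleRing (𝓞 E) E)) i j =
    ((adelicVal F E c 3 _ ((quasiSplit F E c 3).toAdelic h) : GL (Fin 3) (AdeleRing (𝓞 E) E)) :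
      Matrix (Fin 3) (Fin 3) (AdeleRing (𝓞 E) E)) i j
  rw [coe_adelicVal_toAdelic_map, coe_glDiagonal]
  conv_rhs => rw [hd]
  fin_cases i <;> fin_cases j <;> simp

/-- **`γ♯ = ι(d(a, b, (c a)⁻¹)) ∈ T(𝔸_F)`.** [cite: Rogawski1990, §1.9 (p. 9); §6.1 (p. 79)] -/
theorem coe_mk_toAdelic_mem_torusAdelic_of_eq_hyperbolicDiagonal {g₀ : (quasiSplit F E c 3).Rational} {a b : Eˣ}
    (hg₀ : ((g₀.1 : GL (Fin 3) E) : Matrix (Fin 3) (Fin 3) E) = !![(a : E), 0, 0; 0, b, 0; 0, 0, (c (a : E))⁻¹]) :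
    ((⟨(quasiSplit F E c 3).toAdelic g₀, g₀, rfl⟩ : (quasiSplit F E c 3).arithmeticSubgroup) : (quasiSplit F E c 3).Adelic) ∈
      torusAdelic F E c 3 := by
  refine toAdelic_mem_torusAdelic_of_eq_diagonal ?_
  conv_lhs => rw [hg₀]
  rw [hg₀]
  simp

/-- **THE CENTRALISER OF `γ♯` IN `G(F)` LIES IN `T(𝔸_F)`**: if `δ γ♯ = γ♯ δ` with `δ ∈ G(F)` then `δ ∈ T(𝔸_F)` —
`δ = ι(h)` with `h` commuting with the regular diagonal `d(a, b, (c a)⁻¹)`, hence diagonal (★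
`blockTriangular_of_commute_regular`, ★ `hyperbolic_roots_pairwise_ne`). [cite: Rogawski1990, §3.6 (p. 27); §6.1 (p. 79)] -/
theorem coe_mem_torusAdelic_of_commute_hyperbolic (hc : c * c = 1) {a b : Eˣ} (ha : c (a : E) * (a : E) ≠ 1)
    (hb : c (b : E) * (b : E) = 1) {g₀ : (quasiSplit F E c 3).Rational}
    (hg₀ : ((g₀.1 : GL (Fin 3) E) : Matrix (Fin 3) (Fin 3) E) = !![(a : E), 0, 0; 0, b, 0; 0, 0, (c (a : E))⁻¹])
    {δ : (quasiSplit F E c 3).arithmeticSubgroup}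
    (hδ : δ * ⟨(quasiSplit F E c 3).toAdelic g₀, g₀, rfl⟩ = ⟨(quasiSplit F E c 3).toAdelic g₀, g₀, rfl⟩ * δ) :
    ((δ : (quasiSplit F E c 3).arithmeticSubgroup) : (quasiSplit F E c 3).Adelic) ∈ torusAdelic F E c 3 := by
  obtain ⟨hab, haa', hba'⟩ := hyperbolic_roots_pairwise_ne (F := F) hc ha hb
  obtain ⟨h, hh⟩ := δ.2
  have hcomm : h * g₀ = g₀ * h := by
    apply toAdelic_injective_fibre
    rw [map_mul, map_mul, hh]
    exact congrArg (fun x : (quasiSplit F E c 3).arithmeticSubgroup => (x : (quasiSplit F E c 3).Adelic)) hδ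
  obtain ⟨hB, h01, h02, h12⟩ := blockTriangular_of_commute_regular hg₀ hab haa' hba' hcomm
  have hdmat : ((h.1 : GL (Fin 3) E) : Matrix (Fin 3) (Fin 3) E) =
      !![((h.1 : GL (Fin 3) E) : Matrix (Fin 3) (Fin 3) E) 0 0, 0, 0; 0, ((h.1 : GL (Fin 3) E) : Matrix (Fin 3) (Fin 3) E) 1 1, 0;
        0, 0, ((h.1 : GL (Fin 3) E) : Matrix (Fin 3) (Fin 3) E) 2 2] := by
    have h10 : ((h.1 : GL (Fin 3) E) : Matrix (Fin 3) (Fin 3) E) 1 0 = 0 := hB (show ((0 : Fin 3) : Fin 3) < 1 by decide)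
    have h20 : ((h.1 : GL (Fin 3) E) : Matrix (Fin 3) (Fin 3) E) 2 0 = 0 := hB (show ((0 : Fin 3) : Fin 3) < 2 by decide)
    have h21 : ((h.1 : GL (Fin 3) E) : Matrix (Fin 3) (Fin 3) E) 2 1 = 0 := hB (show ((1 : Fin 3) : Fin 3) < 2 by decide)
    ext i j; fin_cases i <;> fin_cases j <;> simp [h01, h02, h12, h10, h20, h21]
  rw [← hh]
  exact toAdelic_mem_torusAdelic_of_eq_diagonal hdmat

/-- **ELEMENTS OF `T(𝔸_F)` COMMUTE** (diagonal matrices over the commutative ring `𝔸_E`; `adelicVal` is injective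
★ `adelicVal_injective`). [cite: Rogawski1990, §1.9 (p. 9)] -/
theorem mul_eq_mul_of_mem_torusAdelic {s t : (quasiSplit F E c 3).Adelic} (hs : s ∈ torusAdelic F E c 3)
    (ht : t ∈ torusAdelic F E c 3) : s * t = t * s := by
  obtain ⟨d, hd⟩ := hs
  obtain ⟨d', hd'⟩ := ht
  apply adelicVal_injective
  rw [map_mul, map_mul, ← hd, ← hd', ← map_mul, ← map_mul, mul_comm]

/-- **THE CENTRALISER OF `γ♯` IN `G(F)` IS `G(F) ∩ T(𝔸_F)`**: for `δ ∈ G(F)`,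
`δ ∈ Z_{G(F)}(γ♯) ↔ δ ∈ T(𝔸_F)` — `Λ := Subgroup.centralizer {γ♯} ≤ G(F)` is the rational torus `T(F)`, the
lattice of the torus-fibre step of the unfolding of Arthur's `j`-kernel (its hypothesis `hΛ`).
[cite: Rogawski1990, §3.6 (p. 27); §6.1 (pp. 79–81)] [cite: Arthur1978TraceFormulaI, §8] -/
theorem mem_centralizer_mk_toAdelic_hyperbolic_iff_mem_torusAdelic (hc : c * c = 1) {a b : Eˣ}
    (ha : c (a : E) * (a : E) ≠ 1) (hb : c (b : E) * (b : E) = 1) {g₀ : (quasiSplit F E c 3).Rational}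
    (hg₀ : ((g₀.1 : GL (Fin 3) E) : Matrix (Fin 3) (Fin 3) E) = !![(a : E), 0, 0; 0, b, 0; 0, 0, (c (a : E))⁻¹])
    (δ : (quasiSplit F E c 3).arithmeticSubgroup) :
    δ ∈ Subgroup.centralizer
        ({⟨(quasiSplit F E c 3).toAdelic g₀, g₀, rfl⟩} : Set (quasiSplit F E c 3).arithmeticSubgroup) ↔
      ((δ : (quasiSplit F E c 3).arithmeticSubgroup) : (quasiSplit F E c 3).Adelic) ∈ torusAdelic F E c 3 := by
  rw [Subgroup.mem_centralizer_singleton_iff]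
  constructor
  · intro hδ
    exact coe_mem_torusAdelic_of_commute_hyperbolic hc ha hb hg₀ hδ
  · intro hδ
    exact Subtype.ext (by
      simpa only [Subgroup.coe_mul] using
        mul_eq_mul_of_mem_torusAdelic hδ (coe_mk_toAdelic_mem_torusAdelic_of_eq_hyperbolicDiagonal hg₀))

end Centraliser

end UnitaryGroup

end Literature.NumberTheory.Automorphic
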